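import Summits.CriticalPhenomena.PercolationContinuityZ3.Theorems.PercNearOneGluingNoHeavyLowerTailSahiGridThree
import Summits.CriticalPhenomena.PercolationContinuityZ3.Theorems.PercNearOneGluingNoHeavyLowerTailSahiThreeDimFixedOrder
import Summits.CriticalPhenomena.PercolationContinuityZ3.Theorems.PercNearOneGluingNoHeavyLowerTailSahiWidthThreeExamples
import Summits.CriticalPhenomena.PercolationContinuityZ3.Theorems.PercNearOneGluingNoHeavyLowerTailSahiTwoLayer
import Summits.CriticalPhenomena.PercolationContinuityZ3.Theorems.PercNearOneGluingNoHeavyLowerTailSahiGridPatternKernel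

/-!
# `NoHeavyLowerTail` (crux stmt-CriticalPhenomena-4575), Sahi programme P1: Sahi's `C₃` in dimension three — UNCONDITIONAL
# corollaries for products of three chains and the formerly "smallest open" lattices

Support file (Sahi cell, seat `prim-sahi-p1`, generation 6; `--supports stmt-CriticalPhenomena-4575`).  Pure proofs.  Originally resting on
`SahiGrid3.liebSahi_grid_three_three` / `uniformGrid_three_three` / `fkg_grid_three_three` (`…SahiGridThree`, COMPUTATIONAL certificate);
RE-BASED 2026-08-21 (prim-bnk-2 gen 13, proof-only change, statements untouched) on the KERNEL `[3]³` pattern inequality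
`SahiGridPattern.sStarD_three_nonneg` (`…SahiGridPatternKernel`) through `uniformGrid_of_patternPos` /
`sahiPositive_three_of_latticeEmbedding_of_patternPos`, so every declaration below now has standard axioms.

The earlier files of the programme proved these statements UNDER the hypothesis `U(3,n)` / the three-chain product hypothesis `H3`;
at order `n = 3` that hypothesis is now a theorem, so we record the unconditional forms:
* `prodBox_three`: every FKG probability weight on every box `([a+1]×[b+1])×[c+1]` is Sahi-positive of order 3 (sublattice of the
  cube grid `Fin 3 → Fin (a+b+c+1)` by `boxEmb`);
* `prodWeight₃_three`: the three-chain product hypothesis `H3` of `…SahiThreeDimFixedOrder` at order 3; hence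
  `fkg_prod₃_three`, `fkg_prod₃_three'`: EVERY FKG probability weight on EVERY product `(α × β) × γ` / `α × β × γ` of three finite
  chains is Sahi-positive of order 3, and `sahiPositive_three_of_latticeEmbedding_prod₃` for lattices embedding into such a product;
* the named small lattices: `prod223_three` (`[2]×[2]×[3]`, 12 elements — the smallest lattice on which `C₃` was not a tree
  theorem), `withBotSqTwo_three` (`V+pt`), `withTopSqTwo_three` (`Λ+pt`), and the whole TWO-LAYER class `twoLayer_three`
  (`[2]×[b+1]²`; at `n = 3` this is the two-row Lieb–Sahi inequality for all `M` and all row weights, `SahiLayer.twoLayer_three_iff_upSets`).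
[this work]
-/

namespace Summit.CriticalPhenomena.PercolationContinuityZ3.Theorems.SahiGrid3

open Finset Literature.Combinatorics.Sahi2008

noncomputable section

/-! ### Boxes with unequal sides -/

/-- The box `([a+1]×[b+1])×[c+1]` inside the cube grid `[a+b+c+1]³`. [this work] -/
def boxEmb (a b c : ℕ) (p : (Fin (a + 1) × Fin (b + 1)) × Fin (c + 1)) : Fin 3 → Fin (a + b + c + 1) :=
  ![Fin.castLE (by omega) p.1.1, Fin.castLE (by omega) p.1.2, Fin.castLE (by omega) p.2]

/-- `boxEmb` is injective. [this work] -/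
theorem boxEmb_injective (a b c : ℕ) : Function.Injective (boxEmb a b c) := by
  intro p q h
  have h0 := congrFun h 0
  have h1 := congrFun h 1
  have h2 := congrFun h 2
  simp only [boxEmb, Matrix.cons_val_zero, Matrix.cons_val_one, Matrix.cons_val_two, Matrix.head_cons, Matrix.tail_cons,
    Fin.castLE_inj] at h0 h1 h2
  exact Prod.ext (Prod.ext h0 h1) h2

/-- `Fin.castLE` preserves `⊓`. [folklore] -/
theorem castLE_inf' {m n : ℕ} (h : m ≤ n) (x y : Fin m) : Fin.castLE h (x ⊓ y) = Fin.castLE h x ⊓ Fin.castLE h y := by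
  rcases le_total x y with hxy | hxy
  · rw [inf_eq_left.2 hxy, inf_eq_left.2 (show Fin.castLE h x ≤ Fin.castLE h y from hxy)]
  · rw [inf_eq_right.2 hxy, inf_eq_right.2 (show Fin.castLE h y ≤ Fin.castLE h x from hxy)]

/-- `Fin.castLE` preserves `⊔`. [folklore] -/
theorem castLE_sup' {m n : ℕ} (h : m ≤ n) (x y : Fin m) : Fin.castLE h (x ⊔ y) = Fin.castLE h x ⊔ Fin.castLE h y := by
  rcases le_total x y with hxy | hxy
  · rw [sup_eq_right.2 hxy, sup_eq_right.2 (show Fin.castLE h x ≤ Fin.castLE h y from hxy)]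
  · rw [sup_eq_left.2 hxy, sup_eq_left.2 (show Fin.castLE h y ≤ Fin.castLE h x from hxy)]

/-- `boxEmb` preserves meets. [this work] -/
theorem boxEmb_inf (a b c : ℕ) (p q : (Fin (a + 1) × Fin (b + 1)) × Fin (c + 1)) :
    boxEmb a b c (p ⊓ q) = boxEmb a b c p ⊓ boxEmb a b c q := by
  funext i
  fin_cases i
  · exact castLE_inf' (by omega) p.1.1 q.1.1
  · exact castLE_inf' (by omega) p.1.2 q.1.2
  · exact castLE_inf' (by omega) p.2 q.2

/-- `boxEmb` preserves joins. [this work] -/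
theorem boxEmb_sup (a b c : ℕ) (p q : (Fin (a + 1) × Fin (b + 1)) × Fin (c + 1)) :
    boxEmb a b c (p ⊔ q) = boxEmb a b c p ⊔ boxEmb a b c q := by
  funext i
  fin_cases i
  · exact castLE_sup' (by omega) p.1.1 q.1.1
  · exact castLE_sup' (by omega) p.1.2 q.1.2
  · exact castLE_sup' (by omega) p.2 q.2

/-- **Every FKG probability weight on every box `([a+1]×[b+1])×[c+1]` is Sahi-positive of order 3.** [this work] -/
theorem prodBox_three {a b c : ℕ} {μ : (Fin (a + 1) × Fin (b + 1)) × Fin (c + 1) → ℝ} (hμ : IsFKGMeasure μ) :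
    SahiPositive μ 3 :=
  SahiGridPattern.sahiPositive_three_of_latticeEmbedding_of_patternPos (fun A B C => SahiGridPattern.sStarD_three_nonneg A B C)
    (boxEmb a b c) (boxEmb_injective a b c) (boxEmb_inf a b c) (boxEmb_sup a b c) hμ

/-- **The three-chain product hypothesis `H3` of `…SahiThreeDimFixedOrder` holds at order 3**: every product probability weight
`w₁ ⊗ w₂ ⊗ w₃` on `([a+1]×[b+1])×[c+1]` is Sahi-positive of order 3. [this work] -/
theorem prodWeight₃_three : ∀ (a b c : ℕ) (w₁ : Fin (a + 1) → ℝ) (w₂ : Fin (b + 1) → ℝ) (w₃ : Fin (c + 1) → ℝ),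
    (∀ i, 0 ≤ w₁ i) → ∑ i, w₁ i = 1 → (∀ j, 0 ≤ w₂ j) → ∑ j, w₂ j = 1 → (∀ k, 0 ≤ w₃ k) → ∑ k, w₃ k = 1 →
      SahiPositive (fun p : (Fin (a + 1) × Fin (b + 1)) × Fin (c + 1) => w₁ p.1.1 * w₂ p.1.2 * w₃ p.2) 3 :=
  fun _ _ _ w₁ w₂ w₃ h₁0 h₁1 h₂0 h₂1 h₃0 h₃1 =>
    prodBox_three (SahiThreeDim.isFKGMeasure_prod₃ w₁ w₂ w₃ h₁0 h₁1 h₂0 h₂1 h₃0 h₃1)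

/-! ### Products of three arbitrary finite chains -/

section Chains

variable {α β γ : Type*} [LinearOrder α] [Fintype α] [LinearOrder β] [Fintype β] [LinearOrder γ] [Fintype γ]

/-- **EVERY FKG probability weight on EVERY product of three finite chains is Sahi-positive of order 3** (Lieb–Sahi's
Conjecture 1.1 for `[0,1]³` at `n = 3`, discrete form). [this work] -/
theorem fkg_prod₃_three {μ : (α × β) × γ → ℝ} (hμ : IsFKGMeasure μ) : SahiPositive μ 3 :=
  SahiThreeDim.sahiPositive_of_isFKGMeasure_prod₃_order prodWeight₃_three hμ

/-- The same on `α × β × γ`. [this work] -/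
theorem fkg_prod₃_three' {μ : α × β × γ → ℝ} (hμ : IsFKGMeasure μ) : SahiPositive μ 3 :=
  SahiThreeDim.sahiPositive_of_isFKGMeasure_prod₃_order' prodWeight₃_three hμ

/-- **Lattices of J-width ≤ 3, product form**: every FKG probability weight on a finite distributive lattice with a lattice embedding
into a product of three finite chains is Sahi-positive of order 3. [this work] -/
theorem sahiPositive_three_of_latticeEmbedding_prod₃ {L : Type*} [DistribLattice L] [Fintype L] [DecidableEq L]
    (e : L → (α × β) × γ) (he : Function.Injective e) (hinf : ∀ x y, e (x ⊓ y) = e x ⊓ e y)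
    (hsup : ∀ x y, e (x ⊔ y) = e x ⊔ e y) {μ : L → ℝ} (hμ : IsFKGMeasure μ) : SahiPositive μ 3 :=
  SahiThreeDim.sahiPositive_of_latticeEmbedding_prod₃_order prodWeight₃_three e he hinf hsup hμ

end Chains

/-! ### The formerly smallest open lattices, and the two-layer class -/

/-- **`[2]×[2]×[3]`** (12 elements; the smallest distributive lattice on which Sahi's `C₃` was not a tree theorem before this file):
every FKG probability weight on it is Sahi-positive of order 3. [this work] -/
theorem prod223_three {μ : Fin 2 × Fin 2 × Fin 3 → ℝ} (hμ : IsFKGMeasure μ) : SahiPositive μ 3 :=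
  SahiWidth.sahiPositive_prod223_of_uniform (SahiGridPattern.uniformGrid_of_patternPos fun A B C => SahiGridPattern.sStarD_three_nonneg A B C) hμ

/-- **`V+pt = WithBot(2²)×2`** (10 elements): every FKG probability weight on it is Sahi-positive of order 3. [this work] -/
theorem withBotSqTwo_three {μ : WithBot (Fin 2 × Fin 2) × Fin 2 → ℝ} (hμ : IsFKGMeasure μ) : SahiPositive μ 3 :=
  SahiWidth.sahiPositive_withBotSqTwo_of_uniform (SahiGridPattern.uniformGrid_of_patternPos fun A B C => SahiGridPattern.sStarD_three_nonneg A B C) hμ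

/-- **`Λ+pt = WithTop(2²)×2`** (10 elements): every FKG probability weight on it is Sahi-positive of order 3. [this work] -/
theorem withTopSqTwo_three {μ : WithTop (Fin 2 × Fin 2) × Fin 2 → ℝ} (hμ : IsFKGMeasure μ) : SahiPositive μ 3 :=
  SahiWidth.sahiPositive_withTopSqTwo_of_uniform (SahiGridPattern.uniformGrid_of_patternPos fun A B C => SahiGridPattern.sStarD_three_nonneg A B C) hμ

/-- **THE TWO-LAYER CLASS at order 3**: every FKG probability weight on every `[2] × [b+1]²` is Sahi-positive of order 3 —
equivalently (`SahiLayer.twoLayer_three_iff_upSets`) the two-row Lieb–Sahi inequality holds for all `M` and all row weights.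
[this work] -/
theorem twoLayer_three (b : ℕ) (μ : Fin 2 × (Fin 2 → Fin (b + 1)) → ℝ) (hμ : IsFKGMeasure μ) : SahiPositive μ 3 :=
  SahiLayer.twoLayer_of_uniformGrid_three (SahiGridPattern.uniformGrid_of_patternPos fun A B C => SahiGridPattern.sStarD_three_nonneg A B C) hμ

end

end Summit.CriticalPhenomena.PercolationContinuityZ3.Theorems.SahiGrid3
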